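import Summits.SmoothPoincare4.Statement
import Summits.SmoothPoincare4.SmoothPoincare4.Theses.InformationMetricHadamard
import Summits.SmoothPoincare4.SmoothPoincare4.Theses.EinsteinBulk
import Summits.SmoothPoincare4.SmoothPoincare4.Theorems.InformationMetricHadamardYamabeExtremalSpheresTransport
import Literature.Geometry.Riemannian.AubinYamabeSphere
import Literature.Geometry.Riemannian.RoundSphere
import Literature.Geometry.Riemannian.RiemannianDistance
import HarnessLib

/-!
# `SmoothPoincare4 → YamabeExtremalSpheres`: the crux Y1 is implied by the summit (hardness record)

Negative side of crux `YamabeExtremalSpheres` (item stmt-SmoothPoincare4-7998, "Y1": every closed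
smooth 4-manifold `M ≃ₕ S⁴` is Yamabe-extremal, `Y(M,[g₀]) ≥ (1 − η)·8√6π` for some `g₀`, every
`η > 0`; shared by routes `InformationMetricHadamard` and `EinsteinBulk`), line `Sketch`
(cork-round-refill), lead cycle 1. Both routes' `why_might_fail` and the idea card's BARRIERS §D.1
record that Y1 is *SPC4-shielded*: "false iff some homotopy 4-sphere is Yamabe-thin", i.e. a
refutation of Y1 would exhibit an exotic 4-sphere. This file PROVES that direction, modulo the one
deep analytic input it genuinely needs — the Aubin–Obata theorem that the round metric realises
`Y(S⁴,[g_S]) = 8√6π` (the tree's named fact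
`Literature.Geometry.Riemannian.yamabe_roundMetric_sphere_four`, Aubin 1982, Thm. 6.12; equivalent
to the sharp Sobolev inequality on `S⁴`, `AubinYamabeSphereProofs.lean`):

* `helper_yamabeClause_sphere` (registered helper stub of the line) — the conclusion of Y1 holds
  on the standard `S⁴` itself: take `g₀ = g_S` (the round metric as a Mathlib
  `ContMDiffRiemannianMetric`, `roundMetric.toContMDiffRiemannianMetric`); for `h'` conformal to
  it the fact gives `8√6π·√Vol(h') ≤ ∫ R_{h'}`, and `(1 − η)·8√6π·√Vol ≤ 8√6π·√Vol`.
* `yamabeClause_of_diffeomorph_sphere` — the conclusion of Y1 for every `M` DIFFEOMORPHIC to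
  `S⁴` (`d : M ≅ S⁴`): put `g₀ := d^* g_S` (`riemannianComap`) and transport the Yamabe lower
  bound of `[g_S]` to `[g₀]` along `d` (`helper_yamabeBound_transport`, landed in
  `Theorems/InformationMetricHadamardYamabeExtremalSpheresTransport.lean`: naturality of the
  scalar curvature and of the Riemannian measure under isometric diffeomorphisms) — the base case
  to which every line for Y1 reduces once `M` is recognised as standard.
* `yamabeExtremalSpheres_of_smoothPoincare4 : yamabe_roundMetric_sphere_four → SmoothPoincare4 →
  YamabeExtremalSpheres` — given SPC4, `M ≃ₕ S⁴` yields `d : M ≅ S⁴`.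
* `yamabeExtremalSpheres_einsteinBulk_of_smoothPoincare4` — the same for the twin decl of route
  `EinsteinBulk` (identical statement).
* `not_smoothPoincare4_of_not_yamabeExtremalSpheres` — contrapositive: **given the Aubin–Obata
  fact, a refutation of Y1 is a disproof of SPC4** (a Yamabe-thin homotopy 4-sphere is exotic).

Together with the line's kernel-checked skeleton (`Cruxes/YamabeExtremalSpheres/Lines/Sketch.lean`:
`Θ₄ = 0 ∧ Matveyev ∧ RoundCorkRefill ⇒ Y1`) this pins the crux between its open apex stub and the
summit: `RoundCorkRefill ⇒ Y1 ⇐ SmoothPoincare4`.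

## References

* T. Aubin, *Nonlinear Analysis on Manifolds. Monge–Ampère Equations* (1982), Thm. 6.12.
  [Aubin1982]
* M. Obata, *The conjectures on conformal transformations of Riemannian manifolds*, J. Diff.
  Geom. 6 (1971) 247–258. [Obata1971]
* O. Kobayashi, *Scalar curvature of a metric with unit volume*, Math. Ann. 279 (1987) 253–265
  (the smooth Yamabe invariant; `σ(S⁴) = Y(S⁴)`). [Kobayashi1987]
* B. O'Neill, *Semi-Riemannian Geometry* (1983), Ch. 3, Prop. 3.59 (isometries preserve
  curvature). [ONeill1983]
-/

noncomputable section

-- every `Summit.SmoothPoincare4.SmoothPoincare4.…` name repeats the summit = sub-problem segment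
-- (D-0017 layout)
set_option linter.dupNamespace false

open scoped Manifold ContDiff Topology RealInnerProductSpace
-- Mathlib's scoped instance `Fact (finrank ℝ (EuclideanSpace ℝ (Fin n)) = n)`, feeding the
-- `[Fact (finrank ℝ V = n + 1)]` hypothesis of `roundMetric`
open scoped EuclideanSpace
open Set Function Bundle MeasureTheory Metric
open Literature.Geometry.Riemannian
open Literature.Geometry.Lorentzian Literature.Geometry.Lorentzian.PseudoRiemannianMetric

namespace Summit.SmoothPoincare4.SmoothPoincare4.Theorems.YamabeExtremalSpheres

/-- **The conclusion of Y1 on the standard 4-sphere** (registered helper stub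
`helper_yamabeClause_sphere` of line `Sketch`), from the Aubin–Obata named fact
`yamabe_roundMetric_sphere_four` (Aubin 1982, Thm. 6.12: the round metric realises
`Y(S⁴,[g_S]) = 8√6π`): for every `η > 0` the round metric `g₀ = g_S` on `S⁴ ⊂ ℝ⁵` satisfies
`(1 − η)·8√6π·√Vol(S⁴,h') ≤ ∫ R_{h'} dV_{h'}` for every `C^∞` metric `h'` pointwise conformal to
`g₀` — indeed `8√6π·√Vol ≤ ∫ R_{h'}` by the fact and `1 − η ≤ 1`. [cite: Aubin1982, Thm. 6.12] -/
theorem helper_yamabeClause_sphere :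
    yamabe_roundMetric_sphere_four →
      ∀ η : ℝ, 0 < η →
        ∃ g₀ : Bundle.ContMDiffRiemannianMetric (𝓡 4) ∞ (EuclideanSpace ℝ (Fin 4))
          (TangentSpace (𝓡 4) : Metric.sphere (0 : EuclideanSpace ℝ (Fin 5)) 1 → Type _),
          ∀ (h' : Bundle.ContMDiffRiemannianMetric (𝓡 4) ∞ (EuclideanSpace ℝ (Fin 4))
              (TangentSpace (𝓡 4) : Metric.sphere (0 : EuclideanSpace ℝ (Fin 5)) 1 → Type _))
            [(ofRiemannian h').HasLeviCivita],
            (∃ ψ : Metric.sphere (0 : EuclideanSpace ℝ (Fin 5)) 1 → ℝ, ∀ x, 0 < ψ x ∧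
                ∀ v w : TangentSpace (𝓡 4) x, h'.inner x v w = ψ x * g₀.inner x v w) →
              (1 - η) * (8 * Real.sqrt 6 * Real.pi) *
                  Real.sqrt ((riemannianMeasure h' Set.univ).toReal) ≤
                ∫ x, (ofRiemannian h').scalarCurvature x ∂(riemannianMeasure h') := by
  intro hY η hη
  -- the round metric as a Mathlib Riemannian metric
  set g₀ : Bundle.ContMDiffRiemannianMetric (𝓡 4) ∞ (EuclideanSpace ℝ (Fin 4))
      (TangentSpace (𝓡 4) : Metric.sphere (0 : EuclideanSpace ℝ (Fin 5)) 1 → Type _) :=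
    (roundMetric (n := 4) (EuclideanSpace ℝ (Fin 5))).toContMDiffRiemannianMetric
      isRiemannian_roundMetric with hg₀
  refine ⟨g₀, fun h' _ hconf ↦ ?_⟩
  -- `g₀` is the round metric in the sense of the fact
  have hround : ∀ (y : sphere (0 : EuclideanSpace ℝ (Fin 5)) 1) (v w : TangentSpace (𝓡 4) y),
      g₀.inner y v w =
        inner ℝ
          (mfderiv (𝓡 4) 𝓘(ℝ, EuclideanSpace ℝ (Fin 5))
            ((↑) : sphere (0 : EuclideanSpace ℝ (Fin 5)) 1 → EuclideanSpace ℝ (Fin 5)) y v :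
            EuclideanSpace ℝ (Fin 5))
          (mfderiv (𝓡 4) 𝓘(ℝ, EuclideanSpace ℝ (Fin 5))
            ((↑) : sphere (0 : EuclideanSpace ℝ (Fin 5)) 1 → EuclideanSpace ℝ (Fin 5)) y w :
            EuclideanSpace ℝ (Fin 5)) := by
    intro y v w
    rw [hg₀, toContMDiffRiemannianMetric_inner, roundMetric_apply]
  -- the fact, for `g₀` and `h'`
  have key := hY g₀ hround h' hconf
  -- `(1 - η) · K · √V ≤ K · √V ≤ ∫ R`
  have hK : 0 ≤ 8 * Real.sqrt 6 * Real.pi := by positivity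
  have hV : 0 ≤ Real.sqrt ((riemannianMeasure h' Set.univ).toReal) := Real.sqrt_nonneg _
  have h1 : (1 - η) * (8 * Real.sqrt 6 * Real.pi) *
        Real.sqrt ((riemannianMeasure h' Set.univ).toReal) ≤
      8 * Real.sqrt 6 * Real.pi * Real.sqrt ((riemannianMeasure h' Set.univ).toReal) := by
    have : (1 - η) * (8 * Real.sqrt 6 * Real.pi) ≤ 8 * Real.sqrt 6 * Real.pi := by
      nlinarith
    exact mul_le_mul_of_nonneg_right this hV
  exact h1.trans key

end Summit.SmoothPoincare4.SmoothPoincare4.Theorems.YamabeExtremalSpheres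

namespace Summit.SmoothPoincare4.SmoothPoincare4.Theorems.YamabeExtremalSpheres.Negative

open Summit.SmoothPoincare4.SmoothPoincare4.Theorems.YamabeExtremalSpheres

/-- **The conclusion of Y1 for every 4-manifold DIFFEOMORPHIC to `S⁴`**, given the Aubin–Obata
fact: if `d : M ≅ S⁴` is a `C^∞` diffeomorphism then for every `η > 0` the metric `g₀ := d^* g_S`
(`riemannianComap` of the round metric of `helper_yamabeClause_sphere`) satisfies
`(1 − η)·8√6π·√Vol(M,h') ≤ ∫_M R_{h'} dV_{h'}` for every `h'` pointwise conformal to `g₀` —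
transport of the bound along `d` (`helper_yamabeBound_transport`: `(d⁻¹)^* h'` is conformal to
`g_S`, and `d⁻¹ : (S⁴,(d⁻¹)^*h') → (M,h')` is an isometric diffeomorphism preserving total scalar
curvature and volume; O'Neill 1983, Ch. 3, Prop. 3.59). The base case every line for Y1 reduces
to once `M` is recognised as standard. [cite: Aubin1982, Thm. 6.12] [cite: ONeill1983, Ch. 3, Prop. 3.59] -/
theorem yamabeClause_of_diffeomorph_sphere (hY : yamabe_roundMetric_sphere_four)
    (M : Type) [TopologicalSpace M] [T2Space M] [SecondCountableTopology M]
    [ChartedSpace (EuclideanSpace ℝ (Fin 4)) M] [IsManifold (𝓡 4) ∞ M] [CompactSpace M]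
    [MeasurableSpace M] [BorelSpace M]
    (d : M ≃ₘ⟮𝓡 4, 𝓡 4⟯ Metric.sphere (0 : EuclideanSpace ℝ (Fin 5)) 1) (η : ℝ) (hη : 0 < η) :
    ∃ g₀ : Bundle.ContMDiffRiemannianMetric (𝓡 4) ∞ (EuclideanSpace ℝ (Fin 4))
      (TangentSpace (𝓡 4) : M → Type _),
      ∀ (h' : Bundle.ContMDiffRiemannianMetric (𝓡 4) ∞ (EuclideanSpace ℝ (Fin 4))
          (TangentSpace (𝓡 4) : M → Type _)) [(ofRiemannian h').HasLeviCivita],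
        (∃ ψ : M → ℝ, ∀ x : M, 0 < ψ x ∧ ∀ v w : TangentSpace (𝓡 4) x,
            h'.inner x v w = ψ x * g₀.inner x v w) →
          (1 - η) * (8 * Real.sqrt 6 * Real.pi) *
              Real.sqrt ((riemannianMeasure h' Set.univ).toReal) ≤
            ∫ x, (ofRiemannian h').scalarCurvature x ∂(riemannianMeasure h') := by
  obtain ⟨gS, hgS⟩ := helper_yamabeClause_sphere hY η hη
  -- `g₀ := d^* g_S`
  refine ⟨riemannianComap gS d (d.contMDiff.of_le infty_add_one_le)
    (fun x ↦ (d.mfderivToContinuousLinearEquiv (by simp) x).injective) rfl, ?_⟩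
  intro h' _ hconf
  exact helper_yamabeBound_transport M (Metric.sphere (0 : EuclideanSpace ℝ (Fin 5)) 1) d
    (riemannianComap gS d (d.contMDiff.of_le infty_add_one_le)
      (fun x ↦ (d.mfderivToContinuousLinearEquiv (by simp) x).injective) rfl)
    gS ((1 - η) * (8 * Real.sqrt 6 * Real.pi)) (fun _ _ _ ↦ rfl)
    (fun h _ hc ↦ hgS h hc) h' hconf

/-- **`SmoothPoincare4 → YamabeExtremalSpheres`** (the crux Y1 follows from the summit), GIVEN
the Aubin–Obata named fact `yamabe_roundMetric_sphere_four` (Aubin 1982, Thm. 6.12): for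
`M ≃ₕ S⁴`, SPC4 gives a `C^∞` diffeomorphism `d : M ≅ S⁴`, and
`yamabeClause_of_diffeomorph_sphere` applies. [cite: Aubin1982, Thm. 6.12] -/
theorem yamabeExtremalSpheres_of_smoothPoincare4 (hY : yamabe_roundMetric_sphere_four)
    (hSPC4 : _root_.SmoothPoincare4) :
    Summit.SmoothPoincare4.SmoothPoincare4.Theses.InformationMetricHadamard.YamabeExtremalSpheres := by
  intro M _ _ _ _ _ _ _ _ he η hη
  obtain ⟨d⟩ := hSPC4 M ‹_› ‹_› he
  exact yamabeClause_of_diffeomorph_sphere hY M d η hη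

/-- The same for the twin decl of route `EinsteinBulk` (the two route files state Y1 verbatim
identically; the item stmt-SmoothPoincare4-7998 is shared). [cite: Aubin1982, Thm. 6.12] -/
theorem yamabeExtremalSpheres_einsteinBulk_of_smoothPoincare4 (hY : yamabe_roundMetric_sphere_four)
    (hSPC4 : _root_.SmoothPoincare4) :
    Summit.SmoothPoincare4.SmoothPoincare4.Theses.EinsteinBulk.YamabeExtremalSpheres :=
  yamabeExtremalSpheres_of_smoothPoincare4 hY hSPC4

/-- **A refutation of Y1 is a disproof of SPC4** (contrapositive of
`yamabeExtremalSpheres_of_smoothPoincare4`), given the Aubin–Obata fact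
`yamabe_roundMetric_sphere_four`: a closed smooth homotopy 4-sphere that is Yamabe-thin
(`σ(M) < σ(S⁴) = 8√6π`) is an exotic 4-sphere. This is the formal content of the routes' kill
criterion "false iff some homotopy 4-sphere is Yamabe-thin" in the direction available today; the
converse (`Y1 → SPC4`, i.e. that Yamabe-extremality recognises `S⁴`) is the open content of routes
`EinsteinBulk` / `InformationMetricHadamard`. [cite: Kobayashi1987] -/
theorem not_smoothPoincare4_of_not_yamabeExtremalSpheres (hY : yamabe_roundMetric_sphere_four)
    (h : ¬ Summit.SmoothPoincare4.SmoothPoincare4.Theses.InformationMetricHadamard.YamabeExtremalSpheres) :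
    ¬ _root_.SmoothPoincare4 :=
  fun hS ↦ h (yamabeExtremalSpheres_of_smoothPoincare4 hY hS)

end Summit.SmoothPoincare4.SmoothPoincare4.Theorems.YamabeExtremalSpheres.Negative

end
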